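/-
Copyright (c) 2026 the pub-hodgecm-mathlib formalisation cell (harness21).  Prover seat hodgecm-mathlib-K2E1-p12 (g3), Track B ∕ K2-LIT, h413 = `stmt-HodgeConjecture-24833`,
route of record `HCCMUnconditional`, ROADCARD «5Res ENDGAME BY FAMILIES» AMENDMENT #3 «GENERAL (U,τ) LADDER» rung G10; dealer K2E1-plan (g7) ruling (272): the C7_τ letter
`hEisdef_of_kType` — the `K_∞`-TYPE twin of ★ p860758 `hEisdef_of_trivial_kType` (K2E4-p23), as a NEW file over ★ p860843 `K2E1BlockProjectorRangeU` (K2E2-p12) and ★ p860830 F1_τ: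
a `P`-fixed vector of `(L²_cusp)ᗮ` (`P = P_χ ∘ R_f(e_{K′_f})`) is an `ω`-EIGENVECTOR of the adelic level group `Kad = ⟨ι_∞κ(K) ∪ ι_f(K′_f)⟩` for every character `ω` of `Kad` with
`ω(ι_∞κ k) = χ(k⁻¹)`, `ω(ι_f k_f) = 1` — i.e. it lies in the HEAD_τ space `(L²_cusp)ᗮ ⊓ ⨅_k eigenspace (R k) (ω k)` of ★ p860884.
-/
import Summits.HodgeConjecture.HodgeConjecture.Theorems.K2E1ResidualPartInAtomsCMTwo     -- ★ p860758 (K2E4-p23): `hEisdef_of_trivial_kType`'s world (`P`, `hPdef`, `κ`, `χ`, `e`, cusp datum)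
import Summits.HodgeConjecture.HodgeConjecture.Theorems.K2E1BlockProjectorRangeU         -- ★ p860843 (K2E2-p12): `cm_kType_eigen_of_blockProjector_eq_self`, `cm_level_invariant_of_blockProjector_eq_self`
import Summits.HodgeConjecture.HodgeConjecture.Theorems.K2E1KTypeAverageProjectionU       -- ★ p860830 F1_τ (K2E4-p14): `mem_iInf_eigenspace_iff` (the `(K′,ω)`-isotypic currency of HEAD_τ)
import HarnessLib

/-!
# K2·E1 — `K2E1ResidualEisKTypeDefCMTwo`: THE C7_τ LETTER `hEisdef_of_kType` — `P`-FIXED VECTORS OF `(L²_cusp)ᗮ` LIE IN THE `(Kad, ω)`-ISOTYPIC EISENSTEIN SPACE `Eis_ω`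
# (AMENDMENT #3 G10; the `K_∞`-type twin of ★ p860758 §4, every `N`, every `H`)

Track B ∕ K2-LIT, crux h413 = `stmt-HodgeConjecture-24833`, route of record `HCCMUnconditional`; cell `hodgecm-mathlib`, squad K2, ENGINE E1 (5Res campaign, AMENDMENT #3 «general
(U,τ) ladder»); dealer K2E1-plan (g7) (272) «G10 `hEisdef_of_kType` as a NEW file importing ★ p860758 + ★ p860843 (no edit of K2E4-p23's file)».  THEOREMS ONLY (no `def`, no `instance`,
no notation, no named-fact hypothesis, no `sorry`); lane `--supports stmt-HodgeConjecture-24833 --as helper` (count-neutral).  CLOSES NO SOCKET.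

WHAT.  World of ★ p860758: `π = R` on `L²(μ)` for `U(H)(𝔸_{L⁺}) = (cmDatum L N H).Adelic`, a compact group `K →κ U(H)(L⁺ ⊗ ℝ)` with probability Haar measure `μK`, a multiplicative
`K`-type test function `χ ∈ C_c(K)`, the normalised idempotent `e` of an open compact `K′_f ≤ U(H)(𝔸_{L⁺,f})` (`heK`), and the block projector `P = P_χ ∘L R_f(e)` (`hPdef`).  The adelic
level group is `Kad := Subgroup.closure (ι_∞κ(K) ∪ ι_f(K′_f))` (★ p860758's shape with `hKad := le_rfl`), and its `K`-TYPE is ANY homomorphism `ω : ↥Kad →* ℂ` with the generator values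
`ω(ι_∞ κ k) = χ(k⁻¹)` and `ω(ι_f k_f) = 1` (binders `hωarch`, `hωfin`; the G11 assembler supplies `ω`, e.g. `χ⁻¹ ∘ κ⁻¹ ∘ archPart` when `κ` is injective).  THEN (§2): every `x ∈ (L²_cusp)ᗮ`
with `P x = x` satisfies `R(k) x = ω(k) x` for all `k ∈ Kad`, i.e. `x ∈ (L²_cusp)ᗮ ⊓ ⨅_k eigenspace (R (Kad.subtype k)) (ω k)` — the LEFT-HAND SIDE of ★ HEAD_τ p860884
`orthogonal_inf_isotypic_le_topologicalClosure_biSup_family_kType` ∕ `finite_blocks_kType` at `(K′, ω) := (Kad, ω)`, so `hPEis` = ★ `hPEis_of_letters` ∘ §2 at a general `K_∞`-type.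
PROOF: the generators act as prescribed on `P`-fixed vectors (★ p860843: `R(ι_∞κk) x = χ(k⁻¹)•x`, `R(ι_f k_f) x = x`), and `{g ∈ Kad | R g x = ω(g) x}` is closed under `1`, products and
inverses because `ω` is a homomorphism — `Subgroup.closure_induction`.
* §1 `apply_eq_smul_of_mem_closure` (generic: a homomorphism-weighted eigen-relation propagates from generators to the closure).
* §2 **`hEisdef_of_kType`** (membership in `Eis_ω`; unfold with ★ F1_τ `mem_iInf_eigenspace_iff` for the `∀ k, R k x = ω k • x` currency).
HONEST LABEL: HC_CM is proved only modulo the 7 printed citations (2 remaining named inputs: hLiu418 = `stmt-HodgeConjecture-24832`, h413 = `stmt-HodgeConjecture-24833`) until rung 0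
closes; this file asserts no named fact and closes no socket; count-neutral.

## References
* [DeitmarEchterhoff2014] A. Deitmar, S. Echterhoff, *Principles of Harmonic Analysis* (2nd ed.), Lemma 1.6.3, Lemma 7.2.6.
* [Knapp1986] A. W. Knapp, *Representation Theory of Semisimple Groups*, VIII §3.
* [BorelJacquet1979] A. Borel, H. Jacquet, PSPM 33.1 (1979), §4.1, §4.6.
-/

set_option autoImplicit false
-- the mandated namespace repeats the single-problem summit's segment (`HodgeConjecture.HodgeConjecture`)
set_option linter.dupNamespace false

noncomputable section

open MeasureTheory Filter Topology CompactlySupported NumberField ContRepresentation Set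
open scoped InnerProductSpace ENNReal ComplexConjugate
open Literature.NumberTheory.Automorphic Literature.NumberTheory.Automorphic.UnitaryGroup AdelicGroupData
open Summit.HodgeConjecture.HodgeConjecture.Cruxes.H413.K2E1BlockProjectorRangeU (cm_kType_eigen_of_blockProjector_eq_self cm_level_invariant_of_blockProjector_eq_self)
open Summit.HodgeConjecture.HodgeConjecture.Cruxes.H413.K2E1KTypeAverageProjectionU (mem_iInf_eigenspace_iff)

namespace Summit.HodgeConjecture.HodgeConjecture.Cruxes.H413.K2E1ResidualEisKTypeDefCMTwo

/-! ## §1 Generic: an `ω`-weighted eigen-relation propagates from generators to the subgroup they generate -/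

section Generic

variable {G V : Type*} [Group G] [AddCommGroup V] [Module ℂ V]

/-- **CLOSURE INDUCTION FOR TWISTED EIGEN-RELATIONS**: if `ρ : G →* (V →ₗ V)`-like action satisfies `ρ g x = ω g • x` on a generating set `S` of `Kad = closure S`, for a homomorphism
`ω : ↥Kad →* ℂ`, then `ρ k x = ω k • x` for every `k ∈ Kad` (products: `ω` multiplicative; inverses: `ω k⁻¹ = (ω k)⁻¹`). [cite: DeitmarEchterhoff2014, Lemma 1.6.3] -/
theorem apply_eq_smul_of_mem_closure (ρ : G →* V →ₗ[ℂ] V) {S : Set G} (ω : ↥(Subgroup.closure S) →* ℂ) (x : V)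
    (hS : ∀ (g : G) (hg : g ∈ S), ρ g x = ω ⟨g, Subgroup.subset_closure hg⟩ • x) (k : ↥(Subgroup.closure S)) :
    ρ (k : G) x = ω k • x := by
  obtain ⟨g, hg⟩ := k
  induction hg using Subgroup.closure_induction with
  | mem g hg' => exact hS g hg'
  | one => rw [map_one, Module.End.one_apply, show (⟨1, Subgroup.one_mem _⟩ : ↥(Subgroup.closure S)) = 1 from rfl, map_one, one_smul]
  | mul a b ha hb iha ihb =>
      rw [map_mul, Module.End.mul_apply, ihb, map_smul, iha, smul_smul,
        show (⟨a * b, Subgroup.mul_mem _ ha hb⟩ : ↥(Subgroup.closure S)) = ⟨a, ha⟩ * ⟨b, hb⟩ from rfl, map_mul, mul_comm]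
  | inv a ha ih =>
      have hωa : ω ⟨a, ha⟩ ≠ 0 := by
        intro h0
        have h1 : ω (⟨a, ha⟩⁻¹ * ⟨a, ha⟩) = 1 := by rw [inv_mul_cancel, map_one]
        rw [map_mul, h0, mul_zero] at h1
        exact zero_ne_one h1
      have h : ρ a⁻¹ (ρ a x) = x := by rw [← Module.End.mul_apply, ← map_mul, inv_mul_cancel, map_one, Module.End.one_apply]
      rw [ih, map_smul] at h
      have h' : ρ a⁻¹ x = (ω ⟨a, ha⟩)⁻¹ • x := by
        calc ρ a⁻¹ x = (ω ⟨a, ha⟩)⁻¹ • (ω ⟨a, ha⟩ • ρ a⁻¹ x) := by rw [smul_smul, inv_mul_cancel₀ hωa, one_smul]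
          _ = (ω ⟨a, ha⟩)⁻¹ • x := by rw [h]
      rw [h', show (⟨a⁻¹, Subgroup.inv_mem _ ha⟩ : ↥(Subgroup.closure S)) = ⟨a, ha⟩⁻¹ from rfl, map_inv]

end Generic

/-! ## §2 `hEisdef_of_kType` -/

variable {L : Type} [Field L] [NumberField L] [IsCMField L] {N : ℕ} {H : Matrix (Fin N) (Fin N) L}
  (μ : Measure (cmDatum L N H).automorphicQuotient) [(cmDatum L N H).IsAutomorphicMeasure μ]
  {K : Type*} [Group K] [TopologicalSpace K] [MeasurableSpace K] [BorelSpace K]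
  [MeasurableSpace (finAdelic (↥(maximalRealSubfield L)) L (IsCMField.complexConj L) N H)] [BorelSpace (finAdelic (↥(maximalRealSubfield L)) L (IsCMField.complexConj L) N H)]
  (νf : Measure (finAdelic (↥(maximalRealSubfield L)) L (IsCMField.complexConj L) N H)) [IsFiniteMeasureOnCompacts νf] [νf.IsMulLeftInvariant]
  (κ : K →* UnitaryGroup.arch (↥(maximalRealSubfield L)) L (IsCMField.complexConj L) N H) (hκ : Continuous κ)
  (μK : Measure K) [IsFiniteMeasureOnCompacts μK] [MeasurableMul K] [μK.IsMulLeftInvariant]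
  (χ : C_c(K, ℂ)) (e : C_c((finAdelic (↥(maximalRealSubfield L)) L (IsCMField.complexConj L) N H), ℂ))

/-- **`hEisdef` AT A GENERAL `K_∞`-TYPE** (the τ-twin of ★ p860758 `hEisdef_of_trivial_kType`): with `P = P_χ ∘L R_f(e_{K′_f})` (`hPdef`), `χ` multiplicative, `e` left-`K′_f`-invariant, and ANY
homomorphism `ω : ↥Kad →* ℂ` on `Kad = ⟨ι_∞κ(K) ∪ ι_f(K′_f)⟩` with `ω(ι_∞κ k) = χ(k⁻¹)`, `ω(ι_f k_f) = 1`: every `x ∈ (L²_cusp)ᗮ` with `P x = x` lies in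
`(L²_cusp)ᗮ ⊓ ⨅_{k : ↥Kad} eigenspace (R (Kad.subtype k)) (ω k)` — the `Eis_ω` of ★ HEAD_τ p860884 at `(K′, ω) := (Kad, ω)`. [cite: Knapp1986, VIII §3] [cite: BorelJacquet1979, §4.1] -/
theorem hEisdef_of_kType (hχmul : ∀ k l, χ (k * l) = χ k * χ l)
    (K' : Subgroup (finAdelic (↥(maximalRealSubfield L)) L (IsCMField.complexConj L) N H)) (heK : ∀ k ∈ K', ∀ x, e (k * x) = e x)
    (P : (cmDatum L N H).L2 μ →L[ℂ] (cmDatum L N H).L2 μ) (hPdef : P = ((((cmDatum L N H).rightRegular μ).restrict ((archToAdelic (↥(maximalRealSubfield L)) L (IsCMField.complexConj L) N H).comp κ)).integratedOperator (((cmDatum L N H).isUnitary_rightRegular μ).restrict _)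
          (((cmDatum L N H).isStronglyContinuous_rightRegular_holds μ).restrict _ ((continuous_archToAdelic (↥(maximalRealSubfield L)) L (IsCMField.complexConj L) N H).comp hκ)) μK χ ∘L
        (((cmDatum L N H).rightRegular μ).restrict (finAdelicToAdelic (↥(maximalRealSubfield L)) L (IsCMField.complexConj L) N H)).integratedOperator (((cmDatum L N H).isUnitary_rightRegular μ).restrict _) (((cmDatum L N H).isStronglyContinuous_rightRegular_holds μ).restrict _ (continuous_finAdelicToAdelic (↥(maximalRealSubfield L)) L (IsCMField.complexConj L) N H)) νf e))
    (𝔓 : (cmDatum L N H).ParabolicUnipotentData)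
    (ω : ↥(Subgroup.closure ((Set.range (fun k : K => (archToAdelic (↥(maximalRealSubfield L)) L (IsCMField.complexConj L) N H) (κ k)) ∪ (finAdelicToAdelic (↥(maximalRealSubfield L)) L (IsCMField.complexConj L) N H) '' (K' : Set (finAdelic (↥(maximalRealSubfield L)) L (IsCMField.complexConj L) N H))) : Set (cmDatum L N H).Adelic)) →* ℂ)
    (hωarch : ∀ k : K, ω ⟨(archToAdelic (↥(maximalRealSubfield L)) L (IsCMField.complexConj L) N H) (κ k), Subgroup.subset_closure (Or.inl ⟨k, rfl⟩)⟩ = χ k⁻¹)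
    (hωfin : ∀ (kf : (finAdelic (↥(maximalRealSubfield L)) L (IsCMField.complexConj L) N H)) (hkf : kf ∈ K'), ω ⟨(finAdelicToAdelic (↥(maximalRealSubfield L)) L (IsCMField.complexConj L) N H) kf, Subgroup.subset_closure (Or.inr ⟨kf, hkf, rfl⟩)⟩ = 1) :
    ∀ x : (cmDatum L N H).L2 μ, x ∈ ((cmDatum L N H).cuspidalSubspace μ 𝔓).orthogonal ((cmDatum L N H).isUnitary_rightRegular μ) → P x = x →
      x ∈ ((cmDatum L N H).cuspidalSubspace μ 𝔓).toSubmoduleᗮ ⊓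
        ⨅ k : ↥(Subgroup.closure ((Set.range (fun k : K => (archToAdelic (↥(maximalRealSubfield L)) L (IsCMField.complexConj L) N H) (κ k)) ∪ (finAdelicToAdelic (↥(maximalRealSubfield L)) L (IsCMField.complexConj L) N H) '' (K' : Set (finAdelic (↥(maximalRealSubfield L)) L (IsCMField.complexConj L) N H))) : Set (cmDatum L N H).Adelic)),
          Module.End.eigenspace ((((cmDatum L N H).rightRegular μ) ((Subgroup.closure ((Set.range (fun k : K => (archToAdelic (↥(maximalRealSubfield L)) L (IsCMField.complexConj L) N H) (κ k)) ∪ (finAdelicToAdelic (↥(maximalRealSubfield L)) L (IsCMField.complexConj L) N H) '' (K' : Set (finAdelic (↥(maximalRealSubfield L)) L (IsCMField.complexConj L) N H))) : Set (cmDatum L N H).Adelic)).subtype k) : (cmDatum L N H).L2 μ →L[ℂ] (cmDatum L N H).L2 μ) : (cmDatum L N H).L2 μ →ₗ[ℂ] (cmDatum L N H).L2 μ) (ω k) := by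
  intro x hxo hPx
  refine Submodule.mem_inf.2 ⟨hxo, ?_⟩
  rw [mem_iInf_eigenspace_iff]
  have hx' : (((((cmDatum L N H).rightRegular μ).restrict ((archToAdelic (↥(maximalRealSubfield L)) L (IsCMField.complexConj L) N H).comp κ)).integratedOperator (((cmDatum L N H).isUnitary_rightRegular μ).restrict _)
          (((cmDatum L N H).isStronglyContinuous_rightRegular_holds μ).restrict _ ((continuous_archToAdelic (↥(maximalRealSubfield L)) L (IsCMField.complexConj L) N H).comp hκ)) μK χ ∘L
        (((cmDatum L N H).rightRegular μ).restrict (finAdelicToAdelic (↥(maximalRealSubfield L)) L (IsCMField.complexConj L) N H)).integratedOperator (((cmDatum L N H).isUnitary_rightRegular μ).restrict _) (((cmDatum L N H).isStronglyContinuous_rightRegular_holds μ).restrict _ (continuous_finAdelicToAdelic (↥(maximalRealSubfield L)) L (IsCMField.complexConj L) N H)) νf e)) x = x := by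
    rw [← hPdef]; exact hPx
  -- the generators act as prescribed (★ p860843)
  have hS : ∀ (g : (cmDatum L N H).Adelic) (hg : g ∈ (Set.range (fun k : K => (archToAdelic (↥(maximalRealSubfield L)) L (IsCMField.complexConj L) N H) (κ k)) ∪ (finAdelicToAdelic (↥(maximalRealSubfield L)) L (IsCMField.complexConj L) N H) '' (K' : Set (finAdelic (↥(maximalRealSubfield L)) L (IsCMField.complexConj L) N H)))),
      (ContRepresentation.toRepresentation ℂ (cmDatum L N H).Adelic ((cmDatum L N H).L2 μ) ((cmDatum L N H).rightRegular μ)) g x = ω ⟨g, Subgroup.subset_closure hg⟩ • x := by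
    rintro g (⟨k, rfl⟩ | ⟨kf, hkf, rfl⟩)
    · rw [hωarch k]
      show ((cmDatum L N H).rightRegular μ) _ x = _
      exact cm_kType_eigen_of_blockProjector_eq_self ((cmDatum L N H).rightRegular μ) ((cmDatum L N H).isUnitary_rightRegular μ) ((cmDatum L N H).isStronglyContinuous_rightRegular_holds μ) κ hκ μK χ hχmul _ x hx' k
    · rw [hωfin kf hkf, one_smul]
      show ((cmDatum L N H).rightRegular μ) _ x = _
      exact cm_level_invariant_of_blockProjector_eq_self ((cmDatum L N H).rightRegular μ) ((cmDatum L N H).isUnitary_rightRegular μ) ((cmDatum L N H).isStronglyContinuous_rightRegular_holds μ) νf κ hκ μK χ e K' heK x hx' hkf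
  intro k
  exact apply_eq_smul_of_mem_closure (ContRepresentation.toRepresentation ℂ (cmDatum L N H).Adelic ((cmDatum L N H).L2 μ) ((cmDatum L N H).rightRegular μ)) ω x hS k

end Summit.HodgeConjecture.HodgeConjecture.Cruxes.H413.K2E1ResidualEisKTypeDefCMTwo

end
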